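import Literature.Combinatorics.StablePolynomials.SupportJumpSystem
import Literature.Analysis.Complex.Hurwitz
import Mathlib.Algebra.MvPolynomial.Funext
import Mathlib.Analysis.Complex.Polynomial.Basic
import Mathlib.Topology.UniformSpace.HeineCantor
import HarnessLib

/-!
# Supports of polynomials stable with respect to exteriors of discs (Borcea–Brändén I, Lemma 6.1)

J. Borcea, P. Brändén, *The Lee–Yang and Pólya–Schur programs. I. Linear operators preserving stability*,
Invent. Math. 177 (2009) 541–569 (arXiv:0809.0401), §6.1 "Products of open circular domains":

> **Lemma 6.1.** Let `{C_i}_{i=1}^n` be a family of circular domains, `f ∈ ℂ[z_1,…,z_n]` be of degree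
> `κ ∈ ℕⁿ`, and `J ⊆ [n]` a (possibly empty) set such that `C_j` is the exterior of a disk whenever `j ∈ J`.
> Denote by `g` the polynomial in the variables `z_j`, `j ∈ J`, obtained by setting `z_i = c_i ∈ C_i`
> arbitrarily for `i ∉ J`. If `f` is `C_1 × ⋯ × C_n`-stable then `supp(g)` has a unique maximal element `γ`
> with respect to the standard partial order on `ℕ^J`. […]
>
> *Proof.* Let us first prove the lemma in the case when `J = [n]`. We may assume that `C_j` is the
> exterior of the closed unit disk `𝔻̄` for all `j ∈ [n]`. Suppose that there is no unique maximal element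
> of `supp(f)`. For fixed `λ ∈ ℝ_+ⁿ` and `β ∈ ℕⁿ` consider the univariate polynomial
> `F(λ,β;t) := K f(λ_1 t^{β_1}, …, λ_n t^{β_n})` […]. By Hurwitz' theorem all elements of `𝒜(β)` are
> `ℂ ∖ 𝔻̄`-stable. However, since there is no unique maximal element of `supp(f)` there exists `β ∈ ℕⁿ`
> such that `𝒜(β)` contains polynomials of different degrees. Hence, as we vary `λ` at least one zero
> must escape to infinity. This is impossible since all the zeros of `F(λ,β;t)` have modulus at most one.

This file proves the case `J = [n]` of Lemma 6.1 (§§2–5) and the leading-coefficient statement behind its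
second half (§6). The case `J = [n]` is the one to which the printed proof reduces (with
`C_j = ℂ ∖ 𝔻̄` after the affine normalisation "we may assume"): if `f ∈ ℂ[z_σ]` has no zero `z` with
`|z_i| > 1` for all `i`, then the support of `f` has a **greatest** element, namely the vector of partial
degrees `κ = degVec f`; equivalently, the "corner" coefficient `a(κ)` is non-zero
(`BorceaBranden_exteriorDisk_support`, `coeff_degVec_ne_zero_of_exteriorDiskStable`). This is the analytic
input of the non-convex circular-domain theory (loc. cit. Notation 6.1, Lemma 6.2, Thm. 6.3; part II,
Lemma 1.6, Cor. 1.7).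

## The proof

We make the printed "zeros escaping to infinity" argument precise as follows. For a weight vector
`β ∈ ℕⁿ` with positive entries the substitution `z_i = t^{β_i} u_i` gives `z^α = t^{⟨α,β⟩} u^α`
(`expWeight β α = ⟨α,β⟩`); the terms of `f` of maximal weight `M` form the *initial form*
`in_β(f) = Σ_{⟨α,β⟩ = M} a(α) z^α` (`initialForm`), which is weighted-homogeneous:
`in_β(f)(s^β u) = s^M in_β(f)(u)` (`eval_smul_initialForm`).

1. (§2, combinatorics) If for every `β` with positive entries the weight `⟨·,β⟩` has a *unique* maximiser
   on `supp(f)`, then `supp(f)` has a greatest element (`exists_greatest_of_weight_maximizers_subsingleton`: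
   take a maximiser `γ` of the total degree; if some `α ∈ supp(f)` had `α_j > γ_j`, the weight
   `β = q·𝟙 + p·e_j` given by the least ratio `p/q = (|γ| - |α'|)/(α'_j - γ_j)` has two maximisers).
2. (§3, algebra) A polynomial with two distinct exponent vectors in its support has a zero all of whose
   coordinates are non-zero (`exists_torus_zero`: single out a coordinate `j` in which the two exponents
   differ, choose the other coordinates off the zero set of the two corresponding `z_j`-coefficients, and
   use that a univariate polynomial with two non-zero coefficients has a non-zero root). Hence if `⟨·,β⟩`
   had two maximisers on `supp(f)`, `in_β(f)` would vanish at a point `v` of the torus and, by weighted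
   homogeneity, at the point `u₀ = s^β v` of the region `|u_i| > 1` for `s` large.
3. (§4, analysis: "no zero escapes to infinity") For `|u_i| > 1` the reversed probe polynomial
   `P_u(τ) = Σ_α a(α) u^α τ^{M - ⟨α,β⟩} = τ^M f(τ^{-β} u)` (`weightProbe`) has no zeros with
   `0 < |τ| < 1` (the point `τ^{-β} u` lies in the region), and `P_u(0) = in_β(f)(u)`. If
   `P_{u₀}(0) = 0`, Hurwitz's theorem (the tree's one-disc form
   `Complex.eventually_exists_zero_mem_ball_of_tendstoUniformlyOn`) applied to the continuous family
   `u ↦ P_u` on a small circle free of zeros of `P_{u₀}` produces, for all `u` near `u₀`, a zero of `P_u`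
   in the small disc — necessarily `τ = 0`; so `in_β(f)` vanishes on a neighbourhood of `u₀`, hence is the
   zero polynomial (`eventually_eval_zero_of_zeroFree_punctured`, `eq_zero_of_eventually_eval_eq_zero`),
   contradicting step 2. So every `⟨·,β⟩` has a unique maximiser and step 1 applies.

## Main results (namespace `Literature.Combinatorics.StablePolynomials`)

* `expWeight`, `initialForm`, `weightProbe` and their evaluation lemmas.
* `exists_greatest_of_weight_maximizers_subsingleton` (step 1), `exists_torus_zero` (step 2),
  `eventually_eval_zero_of_zeroFree_punctured` (step 3, Hurwitz), `weight_maximizer_unique`.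
* **`degVec_mem_support_of_exteriorDiskStable`**, **`coeff_degVec_ne_zero_of_exteriorDiskStable`**,
  **`BorceaBranden_exteriorDisk_support`**, `eq_degVec_of_maximal` — Lemma 6.1 for `J = [n]`,
  `C_j = ℂ ∖ 𝔻̄`.
* §6 (the "Moreover" clause and the case `J ≠ [n]`): `sliceProbe` (the reversed probe in one variable),
  **`eval_leadingSliceCoeff_ne_zero`** — if `f(z with z_j := v) ≠ 0` for `z` in an open set `Ω` and `|v| > 1`,
  the leading coefficient of `f` in `z_j` has no zero on `Ω`; `natDegree_coordPoly_eq_degreeOf` (every such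
  specialisation has degree exactly `deg_{z_j} f`: "`γ` is the same for all choices of `c_i`");
  `eval_leadingSliceCoeff_ne_zero_of_exteriorDiskStable` (all variables in exteriors of discs).

## References

* [BorceaBranden2009] J. Borcea, P. Brändén, Invent. Math. 177 (2009) 541–569, §6.1 Lemma 6.1 and its proof;
  §1.2 Thm. 1.6 (Hurwitz' theorem).
* [Conway1978] J. B. Conway, *Functions of one complex variable I*, Ch. VII Thm. 2.5 (Hurwitz), via the tree's
  `Literature/Analysis/Complex/Hurwitz.lean`.
-/

noncomputable section

open MvPolynomial Finset Filter Metric Topology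

namespace Literature.Combinatorics.StablePolynomials

variable {σ : Type*}

/-! ## §1 Three generic tools -/

section Tools

/-- A univariate complex polynomial with two non-zero coefficients in different degrees has a non-zero
root (otherwise all its roots vanish and it is a monomial). [folklore] -/
private theorem exists_isRoot_ne_zero {P : Polynomial ℂ} {k₁ k₂ : ℕ} (h₁ : P.coeff k₁ ≠ 0)
    (h₂ : P.coeff k₂ ≠ 0) (hne : k₁ ≠ k₂) : ∃ ρ : ℂ, ρ ≠ 0 ∧ P.IsRoot ρ := by
  have hP : P ≠ 0 := fun h => h₁ (by rw [h, Polynomial.coeff_zero])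
  have hprod := Polynomial.C_leadingCoeff_mul_prod_multiset_X_sub_C
    (IsAlgClosed.card_roots_eq_natDegree (p := P))
  by_contra hall
  push Not at hall
  have hroots : P.roots = Multiset.replicate P.natDegree 0 := by
    rw [Multiset.eq_replicate]
    refine ⟨IsAlgClosed.card_roots_eq_natDegree, fun ρ hρ => ?_⟩
    by_contra hρ0
    exact hall ρ hρ0 ((Polynomial.mem_roots hP).1 hρ)
  rw [hroots, Multiset.map_replicate, Multiset.prod_replicate, Polynomial.C_0, sub_zero] at hprod
  have hk : ∀ k, P.coeff k ≠ 0 → k = P.natDegree := fun k hk => by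
    rw [← hprod, Polynomial.coeff_C_mul, Polynomial.coeff_X_pow] at hk
    by_contra h
    exact hk (by rw [if_neg h, mul_zero])
  exact hne ((hk k₁ h₁).trans (hk k₂ h₂).symm)

variable [Fintype σ]

/-- A non-zero polynomial does not vanish identically on the torus `(ℂ ∖ {0})^σ` (apply
`MvPolynomial.funext` to `(Π_i z_i) · p`). [folklore] -/
private theorem exists_eval_ne_zero_forall_ne_zero {p : MvPolynomial σ ℂ} (hp : p ≠ 0) :
    ∃ u : σ → ℂ, (∀ i, u i ≠ 0) ∧ eval u p ≠ 0 := by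
  have hq : (∏ i, X i : MvPolynomial σ ℂ) * p ≠ 0 :=
    mul_ne_zero (Finset.prod_ne_zero_iff.2 fun i _ => X_ne_zero i) hp
  obtain ⟨u, hu⟩ : ∃ u : σ → ℂ, eval u ((∏ i, X i : MvPolynomial σ ℂ) * p) ≠ 0 := by
    by_contra h
    push Not at h
    exact hq (MvPolynomial.funext fun u => by rw [h u, map_zero])
  rw [map_mul, map_prod] at hu
  simp only [eval_X] at hu
  exact ⟨u, fun i hi => hu (by rw [Finset.prod_eq_zero (Finset.mem_univ i) hi, zero_mul]),
    right_ne_zero_of_mul hu⟩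

/-- A polynomial vanishing on a neighbourhood of a point of `ℂ^σ` is zero (`MvPolynomial.funext_set` on a
box of small discs). [folklore] -/
private theorem eq_zero_of_eventually_eval_eq_zero {p : MvPolynomial σ ℂ} {u₀ : σ → ℂ}
    (h : ∀ᶠ u in 𝓝 u₀, eval u p = 0) : p = 0 := by
  obtain ⟨ε, hε, hball⟩ := Metric.eventually_nhds_iff.1 h
  refine MvPolynomial.funext_set (fun i => Metric.ball (u₀ i) ε) (fun i => ?_) fun u hu => ?_
  · have himage : (fun t : ℝ => u₀ i + (t : ℂ)) '' Set.Ioo (0 : ℝ) ε ⊆ Metric.ball (u₀ i) ε := by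
      rintro _ ⟨t, ⟨ht0, htε⟩, rfl⟩
      rw [Metric.mem_ball, dist_eq_norm, add_sub_cancel_left, Complex.norm_real, Real.norm_of_nonneg ht0.le]
      exact htε
    refine Set.Infinite.mono himage ((Set.Ioo_infinite hε).image ?_)
    intro a _ b _ hab
    exact_mod_cast add_left_cancel hab
  · rw [map_zero]
    exact hball ((dist_pi_lt_iff hε).2 fun i => hu i (Set.mem_univ i))

end Tools

/-! ## §2 Weights and the combinatorial step -/

section Weights

variable [Fintype σ]

/-- The weight `⟨α,β⟩ = Σ_i β_i α_i` of an exponent vector `α` for `β ∈ ℕⁿ`: the `t`-degree of the monomial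
`z^α` under the substitution `z_i = λ_i t^{β_i}`. [cite: BorceaBranden2009, §6.1 proof of Lemma 6.1 (the
polynomial `F(λ,β;t) = K f(λ_1 t^{β_1},…,λ_n t^{β_n})`)] -/
def expWeight (β : σ → ℕ) (α : σ →₀ ℕ) : ℕ := ∑ i, β i * α i

/-- For the weight `β = 𝟙`, `⟨α,𝟙⟩ = |α|`. [cite: BorceaBranden2009, §6.1 proof of Lemma 6.1] -/
theorem expWeight_one (α : σ →₀ ℕ) : expWeight (fun _ => 1) α = ∑ i, α i := by
  simp [expWeight]

/-- **The combinatorial step.** If for every weight vector `β` with positive entries the weight `⟨·,β⟩` has at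
most one maximiser on the finite non-empty set `S ⊆ ℕⁿ`, then `S` has a greatest element (in particular a
unique maximal element). [cite: BorceaBranden2009, §6.1 proof of Lemma 6.1 ("since there is no unique maximal
element of `supp(f)` there exists `β ∈ ℕⁿ` such that `𝒜(β)` contains polynomials of different degrees")] -/
theorem exists_greatest_of_weight_maximizers_subsingleton [DecidableEq σ] {S : Finset (σ →₀ ℕ)}
    (hS : S.Nonempty)
    (h : ∀ β : σ → ℕ, (∀ i, 0 < β i) → ∀ a ∈ S, ∀ b ∈ S,
      (∀ c ∈ S, expWeight β c ≤ expWeight β a) → (∀ c ∈ S, expWeight β c ≤ expWeight β b) → a = b) :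
    ∃ γ ∈ S, ∀ α ∈ S, α ≤ γ := by
  set w1 : (σ →₀ ℕ) → ℕ := expWeight fun _ => 1 with hw1
  obtain ⟨γ, hγ, hmax⟩ := Finset.exists_max_image S w1 hS
  refine ⟨γ, hγ, fun α hα => ?_⟩
  by_contra hle
  obtain ⟨j, hj⟩ : ∃ j, γ j < α j := by
    by_contra hall
    push Not at hall
    exact hle (Finsupp.le_def.2 hall)
  set Sj := S.filter fun c => γ j < c j with hSj
  have hSj_ne : Sj.Nonempty := ⟨α, Finset.mem_filter.2 ⟨hα, hj⟩⟩
  obtain ⟨a, ha, hmin⟩ :=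
    Finset.exists_min_image Sj (fun c => ((w1 γ : ℚ) - w1 c) / ((c j : ℚ) - γ j)) hSj_ne
  obtain ⟨haS, haj⟩ := Finset.mem_filter.1 ha
  set p : ℕ := w1 γ - w1 a with hp
  set q : ℕ := a j - γ j with hq
  have hpw : w1 a + p = w1 γ := Nat.add_sub_cancel' (hmax a haS)
  have hqj : γ j + q = a j := Nat.add_sub_cancel' haj.le
  have hq0 : 0 < q := by omega
  set β : σ → ℕ := fun i => if i = j then q + p else q with hβ
  have hβpos : ∀ i, 0 < β i := fun i => by
    simp only [hβ]
    split_ifs <;> omega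
  have hwβ : ∀ c : σ →₀ ℕ, expWeight β c = q * w1 c + p * c j := fun c => by
    simp only [expWeight, hβ, hw1, one_mul]
    have key : ∀ i, (if i = j then q + p else q) * c i = q * c i + (if i = j then p * c i else 0) :=
      fun i => by split_ifs <;> ring
    simp_rw [key, Finset.sum_add_distrib, Finset.sum_ite_eq', Finset.mem_univ, if_true, Finset.mul_sum]
  -- `γ` maximises the weight `β` …
  have hmaxγ : ∀ c ∈ S, expWeight β c ≤ expWeight β γ := by
    intro c hc
    rw [hwβ, hwβ]
    have hcw : w1 c ≤ w1 γ := hmax c hc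
    by_cases hcj : γ j < c j
    · have hmc := hmin c (Finset.mem_filter.2 ⟨hc, hcj⟩)
      rw [div_le_div_iff₀ (sub_pos.2 (by exact_mod_cast haj)) (sub_pos.2 (by exact_mod_cast hcj))]
        at hmc
      have e1 : ((w1 γ : ℚ) - w1 a) = p := by rw [← hpw]; push_cast; ring
      have e2 : ((a j : ℚ) - γ j) = q := by rw [← hqj]; push_cast; ring
      rw [e1, e2] at hmc
      have key : (q : ℚ) * w1 c + p * c j ≤ q * w1 γ + p * γ j := by linarith
      exact_mod_cast key
    · push Not at hcj
      nlinarith [Nat.mul_le_mul_left q hcw, Nat.mul_le_mul_left p hcj]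
  -- … and so does `a ≠ γ`
  have hmaxa : ∀ c ∈ S, expWeight β c ≤ expWeight β a := by
    have heq : expWeight β a = expWeight β γ := by
      rw [hwβ, hwβ, ← hpw, ← hqj]
      ring
    intro c hc
    rw [heq]
    exact hmaxγ c hc
  have hγa := h β hβpos γ hγ a haS hmaxγ hmaxa
  rw [hγa] at haj
  exact lt_irrefl _ haj

/-- **The initial form** `in_β(f) = Σ_{⟨α,β⟩ = M} a(α) z^α` (for `M` the top weight: the leading coefficient in
`t` of `f(t^{β_1} u_1,…,t^{β_n} u_n)`, as a polynomial in `u`). [cite: BorceaBranden2009, §6.1 proof of Lemma 6.1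
(the degree of `F(λ,β;t)` and the normalising constant `K(λ,β)`)] -/
def initialForm (β : σ → ℕ) (M : ℕ) (f : MvPolynomial σ ℂ) : MvPolynomial σ ℂ :=
  ∑ α ∈ f.support with expWeight β α = M, monomial α (coeff α f)

/-- Coefficients of the initial form. [cite: BorceaBranden2009, §6.1 proof of Lemma 6.1] -/
theorem coeff_initialForm [DecidableEq σ] (β : σ → ℕ) (M : ℕ) (f : MvPolynomial σ ℂ) (α : σ →₀ ℕ) :
    coeff α (initialForm β M f) = if expWeight β α = M then coeff α f else 0 := by
  rw [initialForm, coeff_sum]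
  split_ifs with h
  · by_cases hα : α ∈ f.support
    · rw [Finset.sum_eq_single_of_mem α (Finset.mem_filter.2 ⟨hα, h⟩)
        (fun b _ hne => by rw [coeff_monomial, if_neg hne]), coeff_monomial, if_pos rfl]
    · rw [notMem_support_iff.1 hα]
      exact Finset.sum_eq_zero fun b hb => by
        rw [coeff_monomial]
        exact if_neg fun hba => hα (by rw [← hba]; exact (Finset.mem_filter.1 hb).1)
  · exact Finset.sum_eq_zero fun b hb => by
      rw [coeff_monomial]
      exact if_neg fun hba => h (by rw [← hba]; exact (Finset.mem_filter.1 hb).2)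

/-- **Weighted homogeneity of the initial form**: `in_β(f)(s^{β_1}u_1,…,s^{β_n}u_n) = s^M in_β(f)(u)`.
[cite: BorceaBranden2009, §6.1 proof of Lemma 6.1 (the substitution `z_i = λ_i t^{β_i}`)] -/
theorem eval_smul_initialForm (β : σ → ℕ) (M : ℕ) (f : MvPolynomial σ ℂ) (s : ℂ) (u : σ → ℂ) :
    eval (fun i => s ^ β i * u i) (initialForm β M f) = s ^ M * eval u (initialForm β M f) := by
  simp only [initialForm, map_sum, eval_monomial, Finset.mul_sum]
  refine Finset.sum_congr rfl fun α hα => ?_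
  have hM : ∑ i, β i * α i = M := (Finset.mem_filter.1 hα).2
  rw [Finsupp.prod_fintype _ _ fun i => pow_zero _, Finsupp.prod_fintype _ _ fun i => pow_zero _]
  simp_rw [mul_pow, ← pow_mul]
  rw [Finset.prod_mul_distrib, Finset.prod_pow_eq_pow_sum, hM]
  ring

end Weights

/-! ## §3 The algebraic step: a zero on the torus -/

section TorusZero

variable [Fintype σ] [DecidableEq σ]

/-- `Π_i (u with u_j := t)_i^{α_i} = t^{α_j} Π_{i ≠ j} u_i^{α_i}`. [folklore] -/
private theorem prod_update_pow (u : σ → ℂ) (j : σ) (t : ℂ) (α : σ →₀ ℕ) :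
    ∏ i, Function.update u j t i ^ α i = t ^ α j * ∏ i ∈ univ.erase j, u i ^ α i := by
  rw [← Finset.mul_prod_erase univ _ (mem_univ j)]
  simp only [Function.update_self]
  congr 1
  exact Finset.prod_congr rfl fun i hi => by rw [Function.update_of_ne (Finset.ne_of_mem_erase hi)]

/-- `Π_i u_i^{(α with α_j erased)_i} = Π_{i ≠ j} u_i^{α_i}`. [folklore] -/
private theorem prod_pow_erase (u : σ → ℂ) (j : σ) (α : σ →₀ ℕ) :
    ∏ i, u i ^ (Finsupp.erase j α) i = ∏ i ∈ univ.erase j, u i ^ α i := by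
  rw [← Finset.mul_prod_erase univ _ (mem_univ j)]
  simp only [Finsupp.erase_same, pow_zero, one_mul]
  exact Finset.prod_congr rfl fun i hi => by rw [Finsupp.erase_ne (Finset.ne_of_mem_erase hi)]

/-- The coefficient of `z_j^k` in `h`, as a polynomial in the remaining variables. [cite: BorceaBranden2009,
§6.1 proof of Lemma 6.1 (specialising all variables but one)] -/
def sliceCoeff (h : MvPolynomial σ ℂ) (j : σ) (k : ℕ) : MvPolynomial σ ℂ :=
  ∑ α ∈ h.support with α j = k, monomial (α.erase j) (coeff α h)

/-- `h(u_1,…,u_{j-1}, t, u_{j+1},…)` as a univariate polynomial in `t`. [cite: BorceaBranden2009, §6.1 proof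
of Lemma 6.1 (univariate specialisations of `f`)] -/
def coordPoly (h : MvPolynomial σ ℂ) (j : σ) (u : σ → ℂ) : Polynomial ℂ :=
  ∑ α ∈ h.support, Polynomial.monomial (α j) (coeff α h * ∏ i ∈ univ.erase j, u i ^ α i)

/-- `coordPoly h j u (t) = h(u with u_j := t)`. [cite: BorceaBranden2009, §6.1 proof of Lemma 6.1] -/
theorem eval_coordPoly (h : MvPolynomial σ ℂ) (j : σ) (u : σ → ℂ) (t : ℂ) :
    (coordPoly h j u).eval t = eval (Function.update u j t) h := by
  rw [coordPoly, Polynomial.eval_finsetSum, eval_eq']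
  refine Finset.sum_congr rfl fun α _ => ?_
  rw [Polynomial.eval_monomial, prod_update_pow]
  ring

/-- The coefficients of `coordPoly h j u` are the values `sliceCoeff h j k (u)`. [cite: BorceaBranden2009,
§6.1 proof of Lemma 6.1] -/
theorem coeff_coordPoly (h : MvPolynomial σ ℂ) (j : σ) (u : σ → ℂ) (k : ℕ) :
    (coordPoly h j u).coeff k = eval u (sliceCoeff h j k) := by
  rw [coordPoly, Polynomial.finsetSum_coeff, sliceCoeff, map_sum, Finset.sum_filter]
  refine Finset.sum_congr rfl fun α _ => ?_
  rw [Polynomial.coeff_monomial, eval_monomial, Finsupp.prod_fintype _ _ fun i => pow_zero _]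
  by_cases hk : α j = k
  · rw [if_pos hk, if_pos hk, prod_pow_erase]
  · rw [if_neg hk, if_neg hk]

omit [Fintype σ] in
/-- `sliceCoeff h j (α_j)` has the coefficient `a(α)` at `α` with its `j`-th entry erased.
[cite: BorceaBranden2009, §6.1 proof of Lemma 6.1] -/
theorem coeff_erase_sliceCoeff (h : MvPolynomial σ ℂ) (j : σ) {α : σ →₀ ℕ} (hα : α ∈ h.support) :
    coeff (α.erase j) (sliceCoeff h j (α j)) = coeff α h := by
  have hmem : α ∈ h.support.filter (fun b => b j = α j) := Finset.mem_filter.2 ⟨hα, rfl⟩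
  rw [sliceCoeff, coeff_sum, Finset.sum_eq_single_of_mem α hmem]
  · rw [coeff_monomial, if_pos rfl]
  · intro b hb hne
    rw [coeff_monomial]
    refine if_neg fun heq => hne ?_
    rw [← Finsupp.erase_add_single j b, ← Finsupp.erase_add_single j α, heq, (Finset.mem_filter.1 hb).2]

omit [Fintype σ] in
/-- `sliceCoeff h j (α_j) ≠ 0` for `α ∈ supp(h)`. [cite: BorceaBranden2009, §6.1 proof of Lemma 6.1] -/
theorem sliceCoeff_ne_zero (h : MvPolynomial σ ℂ) (j : σ) {α : σ →₀ ℕ} (hα : α ∈ h.support) :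
    sliceCoeff h j (α j) ≠ 0 := fun h0 => by
  have key := coeff_erase_sliceCoeff h j hα
  rw [h0, coeff_zero] at key
  exact (mem_support_iff.1 hα) key.symm

/-- **The algebraic step**: a polynomial with two distinct exponent vectors in its support vanishes at a point
all of whose coordinates are non-zero. [cite: BorceaBranden2009, §6.1 proof of Lemma 6.1 ("there exists
`β ∈ ℕⁿ` such that `𝒜(β)` contains polynomials of different degrees")] -/
theorem exists_torus_zero {h : MvPolynomial σ ℂ} {α₁ α₂ : σ →₀ ℕ} (h₁ : α₁ ∈ h.support)
    (h₂ : α₂ ∈ h.support) (hne : α₁ ≠ α₂) : ∃ u : σ → ℂ, (∀ i, u i ≠ 0) ∧ eval u h = 0 := by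
  obtain ⟨j, hj⟩ : ∃ j, α₁ j ≠ α₂ j := by
    by_contra hall
    push Not at hall
    exact hne (Finsupp.ext hall)
  obtain ⟨u, hu0, hu⟩ := exists_eval_ne_zero_forall_ne_zero
    (mul_ne_zero (sliceCoeff_ne_zero h j h₁) (sliceCoeff_ne_zero h j h₂))
  rw [map_mul] at hu
  have hc₁ : (coordPoly h j u).coeff (α₁ j) ≠ 0 := by
    rw [coeff_coordPoly]
    exact left_ne_zero_of_mul hu
  have hc₂ : (coordPoly h j u).coeff (α₂ j) ≠ 0 := by
    rw [coeff_coordPoly]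
    exact right_ne_zero_of_mul hu
  obtain ⟨ρ, hρ0, hρ⟩ := exists_isRoot_ne_zero hc₁ hc₂ hj
  refine ⟨Function.update u j ρ, fun i => ?_, by rw [← eval_coordPoly]; exact hρ⟩
  by_cases hi : i = j
  · subst hi
    rwa [Function.update_self]
  · rw [Function.update_of_ne hi]
    exact hu0 i

end TorusZero

/-! ## §4 The analytic step: no zero escapes to infinity (Hurwitz) -/

section Hurwitz

/-- **Hurwitz step.** Let `x ↦ P_x` be a family of univariate polynomials whose evaluation `(x,τ) ↦ P_x(τ)`
is jointly continuous, such that for `x` near `x₀` the polynomial `P_x` has no zero `τ` with `0 < |τ| < 1`.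
If `P_{x₀}(0) = 0` and `P_{x₀} ≠ 0` then `P_x(0) = 0` for all `x` near `x₀`: by Hurwitz's theorem on a small
circle around `0` free of zeros of `P_{x₀}`, each nearby `P_x` has a zero in the small disc, which can only be
`τ = 0`. [cite: BorceaBranden2009, §1.2 Thm. 1.6 (Hurwitz' theorem) and §6.1 proof of Lemma 6.1 ("as we vary
`λ` at least one zero must escape to infinity. This is impossible")] -/
theorem eventually_eval_zero_of_zeroFree_punctured {X : Type*} [UniformSpace X]
    [WeaklyLocallyCompactSpace X] (P : X → Polynomial ℂ)
    (hcont : Continuous fun q : X × ℂ => (P q.1).eval q.2) {x₀ : X}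
    (hzero : ∀ᶠ x in 𝓝 x₀, ∀ τ : ℂ, τ ≠ 0 → ‖τ‖ < 1 → (P x).eval τ ≠ 0)
    (h0 : (P x₀).eval 0 = 0) (hne : P x₀ ≠ 0) :
    ∀ᶠ x in 𝓝 x₀, (P x).eval 0 = 0 := by
  -- a radius `r ∈ (0,1)` avoiding the finitely many zeros of `P x₀`
  obtain ⟨r, ⟨hr0, hr1⟩, hrS⟩ : ∃ r ∈ Set.Ioo (0 : ℝ) 1,
      r ∉ (P x₀).roots.toFinset.image (fun ρ => ‖ρ‖) :=
    (Set.Ioo_infinite zero_lt_one).exists_notMem_finset _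
  have hsphere : ∀ τ ∈ sphere (0 : ℂ) r, (P x₀).eval τ ≠ 0 := by
    intro τ hτ hτ0
    refine hrS (Finset.mem_image.2 ⟨τ, Multiset.mem_toFinset.2 ((Polynomial.mem_roots hne).2 hτ0), ?_⟩)
    exact mem_sphere_zero_iff_norm.1 hτ
  -- uniform convergence on the closed disc from joint continuity
  have hunif : TendstoUniformlyOn (fun x τ => (P x).eval τ) (fun τ => (P x₀).eval τ) (𝓝 x₀)
      (closedBall (0 : ℂ) r) := by
    haveI : CompactSpace (closedBall (0 : ℂ) r) :=
      isCompact_iff_compactSpace.1 (isCompact_closedBall _ _)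
    rw [tendstoUniformlyOn_iff_tendstoUniformly_comp_coe]
    exact Continuous.tendstoUniformly (fun x (τ : closedBall (0 : ℂ) r) => (P x).eval (τ : ℂ))
      (hcont.comp (continuous_fst.prodMk (continuous_subtype_val.comp continuous_snd))) x₀
  have hF : ∀ᶠ x in 𝓝 x₀, DiffContOnCl ℂ (fun τ => (P x).eval τ) (ball (0 : ℂ) r) :=
    Eventually.of_forall fun x => (P x).differentiable.diffContOnCl
  have hz := Complex.eventually_exists_zero_mem_ball_of_tendstoUniformlyOn hr0 hF hunif
    (P x₀).continuous.continuousOn h0 hsphere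
  filter_upwards [hz, hzero] with x hx hx'
  obtain ⟨τ, hτ, hτ0⟩ := hx
  by_cases hτ' : τ = 0
  · rwa [hτ'] at hτ0
  · exact absurd hτ0 (hx' τ hτ' ((mem_ball_zero_iff.1 hτ).trans hr1))

variable [Fintype σ]

/-- **The reversed probe polynomial** `P_u(τ) = Σ_{α ∈ supp f} a(α) u^α τ^{M - ⟨α,β⟩}` (`= τ^M f(τ^{-β} u)`,
the reverse of the printed `F(λ,β;t)` with `t = 1/τ`, `λ = u`). [cite: BorceaBranden2009, §6.1 proof of
Lemma 6.1 (the polynomial `F(λ,β;t)`)] -/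
def weightProbe (β : σ → ℕ) (M : ℕ) (f : MvPolynomial σ ℂ) (u : σ → ℂ) : Polynomial ℂ :=
  ∑ α ∈ f.support, Polynomial.monomial (M - expWeight β α) (coeff α f * ∏ i, u i ^ α i)

/-- Evaluation of the probe polynomial. [cite: BorceaBranden2009, §6.1 proof of Lemma 6.1] -/
theorem eval_weightProbe (β : σ → ℕ) (M : ℕ) (f : MvPolynomial σ ℂ) (u : σ → ℂ) (τ : ℂ) :
    (weightProbe β M f u).eval τ =
      ∑ α ∈ f.support, coeff α f * (∏ i, u i ^ α i) * τ ^ (M - expWeight β α) := by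
  simp only [weightProbe, Polynomial.eval_finsetSum, Polynomial.eval_monomial]

/-- `(u, τ) ↦ P_u(τ)` is jointly continuous. [cite: BorceaBranden2009, §6.1 proof of Lemma 6.1 (uniform
convergence on compacts of the `F(λ,β;t)`)] -/
theorem continuous_eval_weightProbe (β : σ → ℕ) (M : ℕ) (f : MvPolynomial σ ℂ) :
    Continuous fun q : (σ → ℂ) × ℂ => (weightProbe β M f q.1).eval q.2 := by
  simp only [eval_weightProbe]
  refine continuous_finsetSum _ fun α _ => ?_
  refine ((continuous_const.mul ?_).mul ((continuous_snd).pow _))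
  exact continuous_finsetProd _ fun i _ => ((continuous_apply i).comp continuous_fst).pow _

/-- `P_u(0) = in_β(f)(u)` when `M` bounds the weights on `supp f`. [cite: BorceaBranden2009, §6.1 proof of
Lemma 6.1 (the leading coefficient of `F(λ,β;t)`)] -/
theorem eval_zero_weightProbe {β : σ → ℕ} {M : ℕ} {f : MvPolynomial σ ℂ}
    (hM : ∀ α ∈ f.support, expWeight β α ≤ M) (u : σ → ℂ) :
    (weightProbe β M f u).eval 0 = eval u (initialForm β M f) := by
  rw [eval_weightProbe, initialForm, map_sum, Finset.sum_filter]
  refine Finset.sum_congr rfl fun α hα => ?_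
  rw [eval_monomial, Finsupp.prod_fintype _ _ fun i => pow_zero _]
  by_cases h : expWeight β α = M
  · rw [if_pos h, h, Nat.sub_self, pow_zero, mul_one]
  · rw [if_neg h, zero_pow (Nat.sub_ne_zero_of_lt (lt_of_le_of_ne (hM α hα) h)), mul_zero]

/-- `P_u(τ) = τ^M f(τ^{-β_1} u_1, …, τ^{-β_n} u_n)` for `τ ≠ 0`. [cite: BorceaBranden2009, §6.1 proof of
Lemma 6.1 (`F(λ,β;t) = K f(λ_1 t^{β_1},…,λ_n t^{β_n})`)] -/
theorem eval_weightProbe_of_ne_zero {β : σ → ℕ} {M : ℕ} {f : MvPolynomial σ ℂ}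
    (hM : ∀ α ∈ f.support, expWeight β α ≤ M) (u : σ → ℂ) {τ : ℂ} (hτ : τ ≠ 0) :
    (weightProbe β M f u).eval τ = τ ^ M * eval (fun i => τ⁻¹ ^ β i * u i) f := by
  rw [eval_weightProbe, eval_eq', Finset.mul_sum]
  refine Finset.sum_congr rfl fun α hα => ?_
  simp_rw [mul_pow, ← pow_mul]
  rw [Finset.prod_mul_distrib, Finset.prod_pow_eq_pow_sum]
  have hw := hM α hα
  have h1 : τ ^ expWeight β α * τ⁻¹ ^ expWeight β α = 1 := by
    rw [← mul_pow, mul_inv_cancel₀ hτ, one_pow]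
  rw [show τ ^ M = τ ^ (M - expWeight β α) * τ ^ expWeight β α by
    rw [← pow_add, Nat.sub_add_cancel hw]]
  unfold expWeight at h1 ⊢
  linear_combination (-(coeff α f * (∏ i, u i ^ α i) * τ ^ (M - ∑ i, β i * α i))) * h1

/-- **No zeros in the punctured disc**: if `f` has no zeros with all `|z_i| > 1`, then for `|u_i| > 1` and
`0 < |τ| ≤ 1` the probe polynomial does not vanish (`τ^{-β} u` lies in the region). [cite: BorceaBranden2009,
§6.1 proof of Lemma 6.1 ("all the zeros of `F(λ,β;t)` have modulus at most one")] -/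
theorem eval_weightProbe_ne_zero {β : σ → ℕ} {M : ℕ} {f : MvPolynomial σ ℂ}
    (hf : ∀ z : σ → ℂ, (∀ i, 1 < ‖z i‖) → eval z f ≠ 0)
    (hM : ∀ α ∈ f.support, expWeight β α ≤ M) {u : σ → ℂ} (hu : ∀ i, 1 < ‖u i‖) {τ : ℂ}
    (hτ0 : τ ≠ 0) (hτ1 : ‖τ‖ ≤ 1) : (weightProbe β M f u).eval τ ≠ 0 := by
  rw [eval_weightProbe_of_ne_zero hM u hτ0]
  refine mul_ne_zero (pow_ne_zero _ hτ0) (hf _ fun i => ?_)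
  rw [norm_mul, norm_pow, norm_inv]
  calc (1 : ℝ) < ‖u i‖ := hu i
    _ = 1 * ‖u i‖ := (one_mul _).symm
    _ ≤ ‖τ‖⁻¹ ^ β i * ‖u i‖ :=
        mul_le_mul_of_nonneg_right (one_le_pow₀ ((one_le_inv₀ (norm_pos_iff.2 hτ0)).2 hτ1))
          (norm_nonneg _)

end Hurwitz

/-! ## §5 Lemma 6.1 (`J = [n]`) -/

section Main

variable [Fintype σ] [DecidableEq σ]

/-- **Uniqueness of weight maximisers.** If `f` has no zero `z` with `|z_i| > 1` for all `i`, then for every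
weight vector `β` with positive entries the weight `⟨·,β⟩` has a unique maximiser on `supp(f)` (two
maximisers would make the initial form vanish at a point of the region `|u_i| > 1`, and then — no zero may
escape to infinity — identically). [cite: BorceaBranden2009, §6.1 proof of Lemma 6.1] -/
theorem weight_maximizer_unique {f : MvPolynomial σ ℂ}
    (hf : ∀ z : σ → ℂ, (∀ i, 1 < ‖z i‖) → eval z f ≠ 0) {β : σ → ℕ} (hβ : ∀ i, 0 < β i)
    {a b : σ →₀ ℕ} (ha : a ∈ f.support) (hb : b ∈ f.support)
    (hma : ∀ c ∈ f.support, expWeight β c ≤ expWeight β a)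
    (hmb : ∀ c ∈ f.support, expWeight β c ≤ expWeight β b) : a = b := by
  by_contra hab
  set M := expWeight β a with hM
  have hMb : expWeight β b = M := le_antisymm (hma b hb) (hmb a ha)
  have hIa : a ∈ (initialForm β M f).support := by
    rw [mem_support_iff, coeff_initialForm, if_pos hM.symm]
    exact mem_support_iff.1 ha
  have hIb : b ∈ (initialForm β M f).support := by
    rw [mem_support_iff, coeff_initialForm, if_pos hMb]
    exact mem_support_iff.1 hb
  -- a zero of the initial form on the torus, scaled into the region `|u_i| > 1`
  obtain ⟨v, hv0, hv⟩ := exists_torus_zero hIa hIb hab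
  set s : ℝ := 1 + ∑ i, ‖v i‖⁻¹ with hs
  have hsum : 0 ≤ ∑ i, ‖v i‖⁻¹ := Finset.sum_nonneg fun i _ => inv_nonneg.2 (norm_nonneg _)
  have hs1 : 1 ≤ s := by rw [hs]; linarith
  set u₀ : σ → ℂ := fun i => (s : ℂ) ^ β i * v i with hu₀
  have hu₀E : ∀ i, 1 < ‖u₀ i‖ := by
    intro i
    have hvi : 0 < ‖v i‖ := norm_pos_iff.2 (hv0 i)
    have hlt : ‖v i‖⁻¹ < s :=
      calc ‖v i‖⁻¹ ≤ ∑ k, ‖v k‖⁻¹ :=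
            Finset.single_le_sum (fun k _ => inv_nonneg.2 (norm_nonneg (v k))) (Finset.mem_univ i)
        _ < s := by rw [hs]; linarith
    simp only [hu₀]
    rw [norm_mul, norm_pow, Complex.norm_real, Real.norm_of_nonneg (by linarith)]
    calc (1 : ℝ) = ‖v i‖⁻¹ * ‖v i‖ := (inv_mul_cancel₀ hvi.ne').symm
      _ < s * ‖v i‖ := mul_lt_mul_of_pos_right hlt hvi
      _ ≤ s ^ β i * ‖v i‖ := mul_le_mul_of_nonneg_right (le_self_pow₀ hs1 (hβ i).ne') (norm_nonneg _)
  have hI0 : eval u₀ (initialForm β M f) = 0 := by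
    simp only [hu₀]
    rw [eval_smul_initialForm, hv, mul_zero]
  -- Hurwitz: the initial form vanishes near `u₀`, hence identically
  have hE : ∀ᶠ u in 𝓝 u₀, ∀ i, 1 < ‖u i‖ := by
    have hopen : IsOpen {u : σ → ℂ | ∀ i, 1 < ‖u i‖} := by
      rw [Set.setOf_forall]
      exact isOpen_iInter_of_finite fun i => isOpen_lt continuous_const (continuous_apply i).norm
    exact hopen.mem_nhds hu₀E
  have hzero : ∀ᶠ u in 𝓝 u₀, ∀ τ : ℂ, τ ≠ 0 → ‖τ‖ < 1 → (weightProbe β M f u).eval τ ≠ 0 :=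
    hE.mono fun u hu τ hτ0 hτ1 => eval_weightProbe_ne_zero hf hma hu hτ0 hτ1.le
  have h0 : (weightProbe β M f u₀).eval 0 = 0 := by rw [eval_zero_weightProbe hma, hI0]
  have hne : weightProbe β M f u₀ ≠ 0 := fun h => by
    have key := eval_weightProbe_ne_zero hf hma hu₀E (τ := 1 / 2) (by norm_num) (by norm_num)
    rw [h, Polynomial.eval_zero] at key
    exact key rfl
  have hev := eventually_eval_zero_of_zeroFree_punctured (weightProbe β M f)
    (continuous_eval_weightProbe β M f) hzero h0 hne
  have hI : initialForm β M f = 0 :=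
    eq_zero_of_eventually_eval_eq_zero (hev.mono fun u hu => by rwa [eval_zero_weightProbe hma] at hu)
  rw [hI, support_zero] at hIa
  exact Finset.notMem_empty _ hIa

/-- **Borcea–Brändén I, Lemma 6.1 (`J = [n]`), corner form.** If `f ∈ ℂ[z_1,…,z_n]` has no zero `z` with
`|z_i| > 1` for all `i` (i.e. `f` is `(ℂ ∖ 𝔻̄)ⁿ`-stable), then the vector of partial degrees
`κ = (deg_{z_1} f, …, deg_{z_n} f)` lies in the support of `f`. [cite: BorceaBranden2009, §6.1 Lemma 6.1] -/
theorem degVec_mem_support_of_exteriorDiskStable {f : MvPolynomial σ ℂ}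
    (hf : ∀ z : σ → ℂ, (∀ i, 1 < ‖z i‖) → eval z f ≠ 0) : degVec f ∈ f.support := by
  have hf0 : f ≠ 0 := fun h => hf (fun _ => 2) (fun i => by norm_num) (by rw [h, map_zero])
  have hS : f.support.Nonempty := Finset.nonempty_iff_ne_empty.2 fun h => hf0 (support_eq_empty.1 h)
  obtain ⟨γ, hγ, hγmax⟩ := exists_greatest_of_weight_maximizers_subsingleton hS
    fun β hβ a ha b hb hma hmb => weight_maximizer_unique hf hβ ha hb hma hmb
  have hγeq : degVec f = γ := by
    ext i
    rw [degVec_apply, degreeOf_eq_sup]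
    exact le_antisymm (Finset.sup_le fun α hα => hγmax α hα i)
      (Finset.le_sup (f := fun m : σ →₀ ℕ => m i) hγ)
  rw [hγeq]
  exact hγ

/-- **Borcea–Brändén I, Lemma 6.1 (`J = [n]`), coefficient form**: the corner coefficient `a(κ)` of a
`(ℂ ∖ 𝔻̄)ⁿ`-stable polynomial is non-zero. [cite: BorceaBranden2009, §6.1 Lemma 6.1] -/
theorem coeff_degVec_ne_zero_of_exteriorDiskStable {f : MvPolynomial σ ℂ}
    (hf : ∀ z : σ → ℂ, (∀ i, 1 < ‖z i‖) → eval z f ≠ 0) : coeff (degVec f) f ≠ 0 :=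
  mem_support_iff.1 (degVec_mem_support_of_exteriorDiskStable hf)

/-- **Borcea–Brändén I, Lemma 6.1 (case `J = [n]`, `C_j = ℂ ∖ 𝔻̄`)**: if `f` is `(ℂ ∖ 𝔻̄)ⁿ`-stable then
`supp(f)` has a unique maximal element with respect to the standard partial order on `ℕⁿ` — indeed a greatest
element, the degree vector `κ`. [cite: BorceaBranden2009, §6.1 Lemma 6.1] -/
theorem BorceaBranden_exteriorDisk_support {f : MvPolynomial σ ℂ}
    (hf : ∀ z : σ → ℂ, (∀ i, 1 < ‖z i‖) → eval z f ≠ 0) :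
    degVec f ∈ f.support ∧ ∀ α ∈ f.support, α ≤ degVec f :=
  ⟨degVec_mem_support_of_exteriorDiskStable hf, fun _ hα => le_degVec (mem_support_iff.1 hα)⟩

/-- **Lemma 6.1, uniqueness of the maximal element**: every maximal element of `supp(f)` is `κ`.
[cite: BorceaBranden2009, §6.1 Lemma 6.1 ("`supp(g)` has a unique maximal element `γ`")] -/
theorem eq_degVec_of_maximal {f : MvPolynomial σ ℂ}
    (hf : ∀ z : σ → ℂ, (∀ i, 1 < ‖z i‖) → eval z f ≠ 0) {α : σ →₀ ℕ} (hα : α ∈ f.support)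
    (hmax : ∀ α' ∈ f.support, α ≤ α' → α' = α) : α = degVec f :=
  (hmax _ (degVec_mem_support_of_exteriorDiskStable hf) (le_degVec (mem_support_iff.1 hα))).symm

end Main

/-! ## §6 Lemma 6.1, second half: leading coefficients in an exterior-disc variable -/

section LeadingCoeff

variable [Fintype σ] [DecidableEq σ]

/-- **The reversed probe in one variable**: `Q_z(w) = Σ_{α ∈ supp f} a(α) (Π_{i≠j} z_i^{α_i}) w^{κ_j - α_j}`
(`= w^{κ_j} f(z with z_j := 1/w)`), `κ_j = deg_{z_j} f`. [cite: BorceaBranden2009, §6.1 proof of Lemma 6.1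
("If `J ≠ [n]` … some zero of a specialization of `f` would escape to infinity")] -/
def sliceProbe (f : MvPolynomial σ ℂ) (j : σ) (z : σ → ℂ) : Polynomial ℂ :=
  ∑ α ∈ f.support, Polynomial.monomial (f.degreeOf j - α j) (coeff α f * ∏ i ∈ univ.erase j, z i ^ α i)

/-- Evaluation of the one-variable probe. [cite: BorceaBranden2009, §6.1 proof of Lemma 6.1] -/
theorem eval_sliceProbe (f : MvPolynomial σ ℂ) (j : σ) (z : σ → ℂ) (w : ℂ) :
    (sliceProbe f j z).eval w =
      ∑ α ∈ f.support, coeff α f * (∏ i ∈ univ.erase j, z i ^ α i) * w ^ (f.degreeOf j - α j) := by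
  simp only [sliceProbe, Polynomial.eval_finsetSum, Polynomial.eval_monomial]

/-- `(z, w) ↦ Q_z(w)` is jointly continuous. [cite: BorceaBranden2009, §6.1 proof of Lemma 6.1] -/
theorem continuous_eval_sliceProbe (f : MvPolynomial σ ℂ) (j : σ) :
    Continuous fun q : (σ → ℂ) × ℂ => (sliceProbe f j q.1).eval q.2 := by
  simp only [eval_sliceProbe]
  refine continuous_finsetSum _ fun α _ => ?_
  refine ((continuous_const.mul ?_).mul ((continuous_snd).pow _))
  exact continuous_finsetProd _ fun i _ => ((continuous_apply i).comp continuous_fst).pow _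

/-- `Q_z(0) = lc_{z_j}(f)(z)`: the value at `0` of the probe is the leading coefficient of `f` in `z_j`
(`sliceCoeff f j κ_j`) evaluated at `z`. [cite: BorceaBranden2009, §6.1 proof of Lemma 6.1] -/
theorem eval_zero_sliceProbe (f : MvPolynomial σ ℂ) (j : σ) (z : σ → ℂ) :
    (sliceProbe f j z).eval 0 = eval z (sliceCoeff f j (f.degreeOf j)) := by
  rw [← coeff_coordPoly, coordPoly, Polynomial.finsetSum_coeff, eval_sliceProbe]
  refine Finset.sum_congr rfl fun α hα => ?_
  rw [Polynomial.coeff_monomial]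
  have hle : α j ≤ f.degreeOf j := monomial_le_degreeOf j hα
  by_cases h : α j = f.degreeOf j
  · rw [if_pos h, h, Nat.sub_self, pow_zero, mul_one]
  · rw [if_neg h, zero_pow (Nat.sub_ne_zero_of_lt (lt_of_le_of_ne hle h)), mul_zero]

/-- `Q_z(w) = w^{κ_j} f(z with z_j := w⁻¹)` for `w ≠ 0`. [cite: BorceaBranden2009, §6.1 proof of Lemma 6.1] -/
theorem eval_sliceProbe_of_ne_zero (f : MvPolynomial σ ℂ) (j : σ) (z : σ → ℂ) {w : ℂ} (hw : w ≠ 0) :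
    (sliceProbe f j z).eval w = w ^ f.degreeOf j * eval (Function.update z j w⁻¹) f := by
  rw [eval_sliceProbe, eval_eq', Finset.mul_sum]
  refine Finset.sum_congr rfl fun α hα => ?_
  rw [prod_update_pow]
  have hle : α j ≤ f.degreeOf j := monomial_le_degreeOf j hα
  have h1 : w ^ α j * w⁻¹ ^ α j = 1 := by rw [← mul_pow, mul_inv_cancel₀ hw, one_pow]
  rw [show w ^ f.degreeOf j = w ^ (f.degreeOf j - α j) * w ^ α j by
    rw [← pow_add, Nat.sub_add_cancel hle]]
  linear_combination (-(coeff α f * (∏ i ∈ univ.erase j, z i ^ α i) * w ^ (f.degreeOf j - α j))) * h1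

/-- **No zero in the punctured disc**: if `f(z with z_j := v) ≠ 0` whenever `|v| > 1`, then `Q_z(w) ≠ 0`
for `0 < |w| < 1`. [cite: BorceaBranden2009, §6.1 proof of Lemma 6.1 ("contradicting the boundedness of the
zeros")] -/
theorem eval_sliceProbe_ne_zero {f : MvPolynomial σ ℂ} {j : σ} {z : σ → ℂ}
    (hf : ∀ v : ℂ, 1 < ‖v‖ → eval (Function.update z j v) f ≠ 0) {w : ℂ} (hw0 : w ≠ 0) (hw1 : ‖w‖ < 1) :
    (sliceProbe f j z).eval w ≠ 0 := by
  rw [eval_sliceProbe_of_ne_zero f j z hw0]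
  refine mul_ne_zero (pow_ne_zero _ hw0) (hf _ ?_)
  rw [norm_inv]
  exact (one_lt_inv₀ (norm_pos_iff.2 hw0)).2 hw1

/-- **Borcea–Brändén I, Lemma 6.1, second half (leading coefficients).** Let `Ω ⊆ ℂ^σ` be open and suppose
that `f(z with z_j := v) ≠ 0` for all `z ∈ Ω` and all `|v| > 1` (the variable `z_j` ranges over the exterior of
the closed unit disc, the others over `Ω`). Then the leading coefficient of `f` in `z_j` — the coefficient of
`z_j^{κ_j}`, `κ_j = deg_{z_j} f`, a polynomial in the remaining variables — has no zero on `Ω`. (Printed: the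
maximal element of the support of a specialization "is the same for all choices of `c_i ∈ C_i`"; otherwise
"some zero of a specialization of `f` would escape to infinity contradicting the boundedness of the zeros".)
[cite: BorceaBranden2009, §6.1 Lemma 6.1 (the "Moreover" clause and the case `J ≠ [n]` of the proof)] -/
theorem eval_leadingSliceCoeff_ne_zero {f : MvPolynomial σ ℂ} {j : σ} {Ω : Set (σ → ℂ)} (hΩ : IsOpen Ω)
    (hf : ∀ z ∈ Ω, ∀ v : ℂ, 1 < ‖v‖ → eval (Function.update z j v) f ≠ 0) {z₀ : σ → ℂ} (hz₀ : z₀ ∈ Ω) :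
    eval z₀ (sliceCoeff f j (f.degreeOf j)) ≠ 0 := by
  intro h0
  have hf0 : f ≠ 0 := fun h => hf z₀ hz₀ 2 (by norm_num) (by rw [h, map_zero])
  -- some exponent vector attains the degree in `z_j`, so the leading slice is a non-zero polynomial
  obtain ⟨α, hα, hαj⟩ : ∃ α ∈ f.support, f.degreeOf j = α j := by
    rw [degreeOf_eq_sup]
    exact Finset.exists_mem_eq_sup _
      (Finset.nonempty_iff_ne_empty.2 fun h => hf0 (support_eq_empty.1 h)) _
  have hslice : sliceCoeff f j (f.degreeOf j) ≠ 0 := by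
    rw [hαj]
    exact sliceCoeff_ne_zero f j hα
  -- Hurwitz step for the one-variable probe
  have hzero : ∀ᶠ z in 𝓝 z₀, ∀ w : ℂ, w ≠ 0 → ‖w‖ < 1 → (sliceProbe f j z).eval w ≠ 0 :=
    Filter.eventually_of_mem (hΩ.mem_nhds hz₀) fun z hz w hw0 hw1 => eval_sliceProbe_ne_zero (hf z hz) hw0 hw1
  have hP0 : (sliceProbe f j z₀).eval 0 = 0 := by rw [eval_zero_sliceProbe, h0]
  have hne : sliceProbe f j z₀ ≠ 0 := fun h => by
    have key := eval_sliceProbe_ne_zero (hf z₀ hz₀) (w := 1 / 2) (by norm_num) (by norm_num)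
    rw [h, Polynomial.eval_zero] at key
    exact key rfl
  have hev := eventually_eval_zero_of_zeroFree_punctured (sliceProbe f j)
    (continuous_eval_sliceProbe f j) hzero hP0 hne
  exact hslice (eq_zero_of_eventually_eval_eq_zero
    (hev.mono fun z hz => by rwa [eval_zero_sliceProbe] at hz))

/-- **The specialisation keeps its degree**: under the hypotheses of `eval_leadingSliceCoeff_ne_zero`, for every
`z ∈ Ω` the univariate specialisation `v ↦ f(z with z_j := v)` has degree exactly `κ_j = deg_{z_j} f` ("`γ` is
the same for all choices of `c_i ∈ C_i`"). [cite: BorceaBranden2009, §6.1 Lemma 6.1 ("Moreover, `γ` is the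
same for all choices of `c_i ∈ C_i`, `i ∉ J`")] -/
theorem natDegree_coordPoly_eq_degreeOf {f : MvPolynomial σ ℂ} {j : σ} {Ω : Set (σ → ℂ)} (hΩ : IsOpen Ω)
    (hf : ∀ z ∈ Ω, ∀ v : ℂ, 1 < ‖v‖ → eval (Function.update z j v) f ≠ 0) {z : σ → ℂ} (hz : z ∈ Ω) :
    (coordPoly f j z).natDegree = f.degreeOf j := by
  refine Polynomial.natDegree_eq_of_le_of_coeff_ne_zero ?_ ?_
  · rw [Polynomial.natDegree_le_iff_coeff_eq_zero]
    intro k hk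
    rw [coeff_coordPoly, sliceCoeff, Finset.filter_eq_empty_iff.2, Finset.sum_empty, map_zero]
    intro α hα hαk
    have := monomial_le_degreeOf j hα
    rw [hαk] at this
    exact absurd this (not_le.2 (by exact_mod_cast hk))
  · rw [coeff_coordPoly]
    exact eval_leadingSliceCoeff_ne_zero hΩ hf hz

/-- **Corollary (all variables in exteriors of discs).** If `f` is `(ℂ ∖ 𝔻̄)ⁿ`-stable then its leading
coefficient in `z_j` is `(ℂ ∖ 𝔻̄)^{n-1}`-stable: it has no zero `z` with `|z_i| > 1` for all `i ≠ j`.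
[cite: BorceaBranden2009, §6.1 Lemma 6.1] -/
theorem eval_leadingSliceCoeff_ne_zero_of_exteriorDiskStable {f : MvPolynomial σ ℂ}
    (hf : ∀ z : σ → ℂ, (∀ i, 1 < ‖z i‖) → eval z f ≠ 0) (j : σ) {z : σ → ℂ}
    (hz : ∀ i, i ≠ j → 1 < ‖z i‖) : eval z (sliceCoeff f j (f.degreeOf j)) ≠ 0 := by
  have hopen : IsOpen {z : σ → ℂ | ∀ i, i ≠ j → 1 < ‖z i‖} := by
    simp only [Set.setOf_forall]
    exact isOpen_iInter_of_finite fun i => isOpen_iInter_of_finite fun _ =>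
      isOpen_lt continuous_const (continuous_apply i).norm
  refine eval_leadingSliceCoeff_ne_zero hopen (fun z' hz' v hv => hf _ fun i => ?_) hz
  by_cases hi : i = j
  · subst hi
    rwa [Function.update_self]
  · rw [Function.update_of_ne hi]
    exact hz' i hi

end LeadingCoeff

end Literature.Combinatorics.StablePolynomials

end
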